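import Summits.AtomisticToContinuum.Crystallization.Theorems.PalmUnimodularRigidityMinimiserShellsResidual
import Summits.AtomisticToContinuum.Crystallization.Theorems.PalmUnimodularRigidityMinimiserShellsEquilibriumInLawShells
import Summits.AtomisticToContinuum.Crystallization.Theorems.PalmUnimodularRigidityMinimiserShellsPeriodicAssembly
import Literature.MathematicalPhysics.StatisticalMechanics.LennardJonesClusters

/-!
# In-situ transfer: cluster coercivity gives the local elastic inequality (stub `stub_inSituTransfer`)

Stub `stub_inSituTransfer` of line `elastic-coarse-to-fine` of crux `MinimiserShells`
(stmt-AtomisticToContinuum-9225, route `PalmUnimodularRigidity`): pure bookkeeping, an implication.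

ASSUME cluster coercivity: some `c > 0` admits, for every slack `ε > 0`, a radius `R > 0` and a charge
`C ≥ 0` such that every finite injective `1/3`-separated `y : Fin N → ℝ³` satisfies
`c·#{i finely bad with every j, dist (y i) (y j) ≤ R, coarsely good} − C·#{j coarsely bad} − ε·N ≤ 𝓔_N(y) − N·e*`
("coarsely good" = `LooseGoodShell (1/20)`, "finely bad" = `¬ GoodShell`, shells read in the counting measure
of `range y − y i`).  THEN the in-situ local inequality `H` holds with the same `c`: for every `ε > 0` some
`R > 0`, `C ≥ 0` make every such `y` and every set `Ω` of coarsely good indices satisfy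
`c·#{i ∈ Ω finely bad} − C·#{i ∈ Ω with some j ∉ Ω, dist (y i) (y j) ≤ R} − ε·#Ω ≤ Σ_{i∈Ω} (𝓔ⁱ(y)/2 − e*)`.

Proof.  Given `ε`, take `R₀, C₀` of the hypothesis for `ε/2`, put `R := R₀ + 5/4 + 13500/ε` and
`C := c + C₀ + (6R+1)³/24`, and restrict `y` to `Ω` along the increasing enumeration
`e : Fin #Ω ↪ Fin N` (`z = y ∘ e`).
* Energy split (`sum_siteEnergy_eq`): `Σ_{i∈Ω} 𝓔ⁱ(y) = 2·𝓔(z) + Σ_{i∈Ω} Σ_{k∉Ω} V(dist (y i) (y k))`.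
* Cross terms (`cross_sum_ge`): within distance `R` each term is `≥ −1/12`; there are none at the sites of
  `Ω` off the `R`-boundary and at most `(6R+1)³` at a boundary site (packing,
  `PeriodicAssembly.card_filter_dist_le`); beyond `R` the terms are `≥ −d⁻⁶/6` and sum to `≥ −13500/R²` per
  site (`EquilibriumInLaw.Shells.sum_inv_pow_six_le_of_far` with `δ = 1/3`, `ρ = R`).
* Locality (`congr_of_deep`, after `NecessityBlocks.congr_count_restrict_image_sub_of_local`): both shell
  predicates read only atoms within `5/4` of the root, so a finely bad `i ∈ Ω` off the `R`-boundary is finely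
  bad in `z` with an `R₀`-neighbourhood coarsely good in `z` (`card_fineBad_le`), and an index coarsely bad
  in `z` is on the `R`-boundary (`card_coarseBad_le`).
* Apply the hypothesis to `z` (`13500/R² ≤ ε`) and add up.
-/

noncomputable section

open MeasureTheory
open scoped ENNReal BigOperators Classical

namespace Summit.AtomisticToContinuum.Crystallization.Theorems.PalmUnimodularRigidityMinimiserShells.InSituTransfer

open Literature.MathematicalPhysics.StatisticalMechanics (lennardJones siteEnergy interactionEnergy PeriodicConfiguration
  card_le_of_separated_of_dist_le two_mul_interactionEnergy sum_sum_map_eq_two_mul_interactionEnergy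
  lennardJones_zero neg_one_div_le_lennardJones)
open Summit.AtomisticToContinuum.Crystallization.Theorems.MinimiserShells.Negative.LoadBearing (eStar GoodShell)
open Summit.AtomisticToContinuum.Crystallization.Theorems.MinimiserShells.Negative.Rootedness (E3)
open Summit.AtomisticToContinuum.Crystallization.Theorems.PalmUnimodularRigidityMinimiserShells.Residual
  (LooseGoodShell looseGoodShell_zero_iff)

/-! ## Enumerations of a set of indices -/

/-- An enumerated index lies in the enumerated set. -/
theorem mem_of_map_eq {N M : ℕ} {Ω : Finset (Fin N)} {e : Fin M ↪ Fin N}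
    (hΩe : Finset.univ.map e = Ω) (a : Fin M) : e a ∈ Ω := by
  rw [← hΩe]
  exact Finset.mem_map_of_mem e (Finset.mem_univ a)

/-- Every index of the enumerated set is enumerated. -/
theorem exists_of_map_eq {N M : ℕ} {Ω : Finset (Fin N)} {e : Fin M ↪ Fin N}
    (hΩe : Finset.univ.map e = Ω) {k : Fin N} (hk : k ∈ Ω) : ∃ a : Fin M, e a = k := by
  rw [← hΩe, Finset.mem_map] at hk
  obtain ⟨a, -, ha⟩ := hk
  exact ⟨a, ha⟩

/-! ## The energy split -/

/-- **Energy split.**  For the Lennard-Jones potential (`V 0 = 0`) and an enumeration `e` of `Ω`: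
`Σ_{i∈Ω} 𝓔ⁱ(y) = 2·𝓔(y ∘ e) + Σ_{i∈Ω} Σ_{k∉Ω} V(dist (y i) (y k))`. -/
theorem sum_siteEnergy_eq {N M : ℕ} (y : Fin N → E3) {Ω : Finset (Fin N)} {e : Fin M ↪ Fin N}
    (hΩe : Finset.univ.map e = Ω) :
    ∑ i ∈ Ω, siteEnergy lennardJones y i =
      2 * interactionEnergy lennardJones (y ∘ e) +
        ∑ i ∈ Ω, ∑ k ∈ Ωᶜ, lennardJones (dist (y i) (y k)) := by
  have h2 := sum_sum_map_eq_two_mul_interactionEnergy lennardJones lennardJones_zero y e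
  rw [hΩe] at h2
  rw [← h2, ← Finset.sum_add_distrib]
  refine Finset.sum_congr rfl fun i _ => ?_
  rw [Finset.sum_add_sum_compl Ω fun k => lennardJones (dist (y i) (y k))]
  unfold siteEnergy
  rw [← Finset.add_sum_erase Finset.univ _ (Finset.mem_univ i), dist_self, lennardJones_zero, zero_add]

/-! ## Cross terms -/

/-- **Near cross terms.**  `Σ_{k ∉ Ω, dist ≤ R} V(dist (y i) (y k)) ≥ −(6R+1)³/12`: each term is `≥ −1/12`
and at most `(6R+1)³` indices lie within `R` of `y i` (packing). -/
theorem near_bound {N : ℕ} (y : Fin N → E3) (hy : Function.Injective y)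
    (hsep : ∀ i j : Fin N, i ≠ j → (1 : ℝ) / 3 ≤ dist (y i) (y j)) (Ω : Finset (Fin N)) {R : ℝ}
    (hR : 0 ≤ R) (i : Fin N) :
    -(1 / 12 * (6 * R + 1) ^ 3) ≤
      ∑ k ∈ Ωᶜ.filter (fun k => dist (y i) (y k) ≤ R), lennardJones (dist (y i) (y k)) := by
  have hcard : ((Ωᶜ.filter (fun k => dist (y i) (y k) ≤ R)).card : ℝ) ≤ (6 * R + 1) ^ 3 := by
    refine le_trans ?_ (PeriodicAssembly.card_filter_dist_le y hy hsep (y i) hR)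
    exact_mod_cast Finset.card_le_card fun k hk =>
      Finset.mem_filter.2 ⟨Finset.mem_univ _, by rw [dist_comm]; exact (Finset.mem_filter.1 hk).2⟩
  have h2 : ∑ _k ∈ Ωᶜ.filter (fun k => dist (y i) (y k) ≤ R), (-(1 / 12) : ℝ) ≤
      ∑ k ∈ Ωᶜ.filter (fun k => dist (y i) (y k) ≤ R), lennardJones (dist (y i) (y k)) :=
    Finset.sum_le_sum fun k _ => by linarith [neg_one_div_le_lennardJones (dist (y i) (y k))]
  rw [Finset.sum_const, nsmul_eq_mul] at h2
  linarith

/-- Off the `R`-boundary there are no near cross terms. -/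
theorem near_zero {N : ℕ} (y : Fin N → E3) (Ω : Finset (Fin N)) {R : ℝ} (i : Fin N)
    (h : ¬ ∃ j : Fin N, j ∉ Ω ∧ dist (y i) (y j) ≤ R) :
    ∑ k ∈ Ωᶜ.filter (fun k => dist (y i) (y k) ≤ R), lennardJones (dist (y i) (y k)) = 0 :=
  Finset.sum_eq_zero fun k hk =>
    (h ⟨k, Finset.mem_compl.1 (Finset.mem_filter.1 hk).1, (Finset.mem_filter.1 hk).2⟩).elim

/-- **Far cross terms.**  For `R ≥ 1/3`: `Σ_{k ∉ Ω, dist > R} V(dist (y i) (y k)) ≥ −13500/R²`, by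
`V(d) ≥ −d⁻⁶/6` and the shell sum with decay `Σ d⁻⁶ ≤ 1000·3⁴·R⁻²` over the `1/3`-separated points beyond `R`. -/
theorem far_bound {N : ℕ} (y : Fin N → E3) (hy : Function.Injective y)
    (hsep : ∀ i j : Fin N, i ≠ j → (1 : ℝ) / 3 ≤ dist (y i) (y j)) (Ω : Finset (Fin N)) {R : ℝ}
    (hR : 1 / 3 ≤ R) (i : Fin N) :
    -(13500 * R⁻¹ ^ 2) ≤
      ∑ k ∈ Ωᶜ.filter (fun k => ¬ dist (y i) (y k) ≤ R), lennardJones (dist (y i) (y k)) := by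
  have himg : ∑ z ∈ (Ωᶜ.filter (fun k => ¬ dist (y i) (y k) ≤ R)).image y, (dist (y i) z)⁻¹ ^ 6 =
      ∑ k ∈ Ωᶜ.filter (fun k => ¬ dist (y i) (y k) ≤ R), (dist (y i) (y k))⁻¹ ^ 6 :=
    Finset.sum_image fun a _ b _ h => hy h
  have h1 : ∑ k ∈ Ωᶜ.filter (fun k => ¬ dist (y i) (y k) ≤ R), (dist (y i) (y k))⁻¹ ^ 6 ≤
      1000 * (1 / 3 : ℝ)⁻¹ ^ 4 * R⁻¹ ^ 2 := by
    rw [← himg]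
    refine EquilibriumInLaw.Shells.sum_inv_pow_six_le_of_far _ (y i) (by norm_num) hR ?_ ?_
    · intro z hz
      obtain ⟨k, hk, rfl⟩ := Finset.mem_image.1 hz
      exact (not_le.1 (Finset.mem_filter.1 hk).2).le
    · intro z hz w hw hzw
      obtain ⟨k, -, rfl⟩ := Finset.mem_image.1 hz
      obtain ⟨l, -, rfl⟩ := Finset.mem_image.1 hw
      exact hsep k l fun h => hzw (congrArg y h)
  have h2 : ∑ k ∈ Ωᶜ.filter (fun k => ¬ dist (y i) (y k) ≤ R), -(1 / 6 * (dist (y i) (y k))⁻¹ ^ 6) ≤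
      ∑ k ∈ Ωᶜ.filter (fun k => ¬ dist (y i) (y k) ≤ R), lennardJones (dist (y i) (y k)) :=
    Finset.sum_le_sum fun k _ => by linarith [EnergyFloor.neg_lennardJones_le (dist (y i) (y k))]
  rw [Finset.sum_neg_distrib, ← Finset.mul_sum] at h2
  have h3 : (1 / 3 : ℝ)⁻¹ ^ 4 = 81 := by norm_num
  rw [h3] at h1
  linarith

/-- **Cross terms, summed over `Ω`.**  For `R ≥ 1/3`:
`Σ_{i∈Ω} Σ_{k∉Ω} V(dist (y i) (y k)) ≥ −(6R+1)³/12 · #(R-boundary of Ω) − 13500/R² · #Ω`. -/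
theorem cross_sum_ge {N : ℕ} (y : Fin N → E3) (hy : Function.Injective y)
    (hsep : ∀ i j : Fin N, i ≠ j → (1 : ℝ) / 3 ≤ dist (y i) (y j)) (Ω : Finset (Fin N)) {R : ℝ}
    (hR : 1 / 3 ≤ R) :
    -(1 / 12 * (6 * R + 1) ^ 3) *
          (Nat.card {i : Fin N // i ∈ Ω ∧ ∃ j : Fin N, j ∉ Ω ∧ dist (y i) (y j) ≤ R} : ℝ) -
        13500 * R⁻¹ ^ 2 * (Ω.card : ℝ) ≤
      ∑ i ∈ Ω, ∑ k ∈ Ωᶜ, lennardJones (dist (y i) (y k)) := by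
  have hR0 : 0 ≤ R := le_trans (by norm_num) hR
  -- per site
  have key : ∀ i ∈ Ω, -(1 / 12 * (6 * R + 1) ^ 3) *
        (if ∃ j : Fin N, j ∉ Ω ∧ dist (y i) (y j) ≤ R then (1 : ℝ) else 0) - 13500 * R⁻¹ ^ 2 ≤
      ∑ k ∈ Ωᶜ, lennardJones (dist (y i) (y k)) := by
    intro i _
    rw [← Finset.sum_filter_add_sum_filter_not Ωᶜ (fun k => dist (y i) (y k) ≤ R)]
    have hfar := far_bound y hy hsep Ω hR i
    split_ifs with h
    · have hnear := near_bound y hy hsep Ω hR0 i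
      linarith
    · have h0 := near_zero y Ω i h
      linarith
  have hsum := Finset.sum_le_sum key
  rw [Finset.sum_sub_distrib, ← Finset.mul_sum, Finset.sum_boole, Finset.sum_const, nsmul_eq_mul] at hsum
  have hD : ((Ω.filter fun i => ∃ j : Fin N, j ∉ Ω ∧ dist (y i) (y j) ≤ R).card : ℝ) =
      Nat.card {i : Fin N // i ∈ Ω ∧ ∃ j : Fin N, j ∉ Ω ∧ dist (y i) (y j) ≤ R} := by
    rw [Nat.card_eq_fintype_card, Fintype.card_subtype]
    exact_mod_cast congrArg Finset.card (by ext i; simp)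
  rw [hD] at hsum
  linarith

/-! ## Locality of the two shell predicates -/

/-- **Deep roots get the same verdict in `y` and in `y|Ω`.**  For a local predicate `G` (two measures with the
same atoms in `B̄(0, 5/4)` get the same verdict), an enumeration `e` of `Ω` and a root `y i` all of whose
`y`-neighbours within `ρ ≥ 5/4` have indices in `Ω`: `G` at `count|((· − y i) '' range y)` iff `G` at
`count|((· − y i) '' range (y ∘ e))`. -/
theorem congr_of_deep {G : Measure E3 → Prop}
    (hloc : ∀ {μ ν : Measure E3}, (∀ w : E3, ‖w‖ ≤ 5 / 4 → (μ {w} ≠ 0 ↔ ν {w} ≠ 0)) → (G μ ↔ G ν))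
    {N M : ℕ} (y : Fin N → E3) {Ω : Finset (Fin N)} {e : Fin M ↪ Fin N}
    (hΩe : Finset.univ.map e = Ω) {i : Fin N} {ρ : ℝ} (hρ : 5 / 4 ≤ ρ)
    (hdeep : ∀ k : Fin N, dist (y i) (y k) ≤ ρ → k ∈ Ω) :
    G ((Measure.count : Measure E3).restrict ((fun z => z - y i) '' Set.range y)) ↔
      G ((Measure.count : Measure E3).restrict ((fun z => z - y i) '' Set.range (y ∘ e))) := by
  refine NecessityBlocks.congr_count_restrict_image_sub_of_local hloc (Set.range_comp_subset_range e y) hρ ?_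
  rintro x ⟨⟨k, rfl⟩, hk⟩
  rw [Metric.mem_closedBall, dist_comm] at hk
  obtain ⟨a, ha⟩ := exists_of_map_eq hΩe (hdeep k hk)
  exact ⟨a, by rw [Function.comp_apply, ha]⟩

/-- **Coarsely bad in `y|Ω` forces the `R`-boundary** (`R ≥ 5/4`): if every index of `Ω` is `θ`-loosely well
shelled in `y` (`θ ≥ 0`), the indices `θ`-loosely badly shelled in `y ∘ e` inject (`b ↦ e b`) into the indices of
`Ω` having an index outside `Ω` within distance `R`. -/
theorem card_coarseBad_le {N M : ℕ} (y : Fin N → E3) {Ω : Finset (Fin N)} {e : Fin M ↪ Fin N}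
    (hΩe : Finset.univ.map e = Ω) {θ R : ℝ} (hθ : 0 ≤ θ) (hR : 5 / 4 ≤ R)
    (hΩ : ∀ i ∈ Ω, LooseGoodShell θ
      ((Measure.count : Measure E3).restrict ((fun z => z - y i) '' Set.range y))) :
    (Nat.card {b : Fin M // ¬ LooseGoodShell θ
        ((Measure.count : Measure E3).restrict ((fun z => z - y (e b)) '' Set.range (y ∘ e)))} : ℝ) ≤
      Nat.card {i : Fin N // i ∈ Ω ∧ ∃ j : Fin N, j ∉ Ω ∧ dist (y i) (y j) ≤ R} := by
  have hbd : ∀ b : Fin M, ¬ LooseGoodShell θ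
      ((Measure.count : Measure E3).restrict ((fun z => z - y (e b)) '' Set.range (y ∘ e))) →
      ∃ j : Fin N, j ∉ Ω ∧ dist (y (e b)) (y j) ≤ R := by
    intro b hb
    by_contra hcon
    refine hb ((congr_of_deep (G := LooseGoodShell θ)
      (fun h => NecessityBlocks.looseGood_congr_of_local hθ h) y hΩe hR fun k hk => ?_).1
      (hΩ _ (mem_of_map_eq hΩe b)))
    by_contra hkΩ
    exact hcon ⟨k, hkΩ, hk⟩
  exact_mod_cast Nat.card_le_card_of_injective
    (fun b : {b : Fin M // ¬ LooseGoodShell θ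
        ((Measure.count : Measure E3).restrict ((fun z => z - y (e b)) '' Set.range (y ∘ e)))} =>
      (⟨e b.1, mem_of_map_eq hΩe b.1, hbd b.1 b.2⟩ :
        {i : Fin N // i ∈ Ω ∧ ∃ j : Fin N, j ∉ Ω ∧ dist (y i) (y j) ≤ R}))
    fun b b' h => Subtype.ext (e.injective (congrArg Subtype.val h))

/-- **Finely bad off the `R`-boundary transfers to `y|Ω`.**  If every index of `Ω` is `θ`-loosely well shelled in
`y` (`θ ≥ 0`), `R ≥ R₀ + 5/4` (`R₀ ≥ 0`), and `e a ∈ Ω` is finely badly shelled in `y` with no index outside `Ω`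
within distance `R`, then `a` is finely badly shelled in `y ∘ e` and every `b` with `dist ≤ R₀` is `θ`-loosely well
shelled in `y ∘ e` (locality of both predicates). -/
theorem fineBad_transfer {N M : ℕ} (y : Fin N → E3) {Ω : Finset (Fin N)} {e : Fin M ↪ Fin N}
    (hΩe : Finset.univ.map e = Ω) {θ R₀ R : ℝ} (hθ : 0 ≤ θ) (hR₀ : 0 ≤ R₀) (hR : R₀ + 5 / 4 ≤ R)
    (hΩ : ∀ i ∈ Ω, LooseGoodShell θ
      ((Measure.count : Measure E3).restrict ((fun z => z - y i) '' Set.range y)))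
    (a : Fin M)
    (hbad : ¬ GoodShell ((Measure.count : Measure E3).restrict ((fun z => z - y (e a)) '' Set.range y)))
    (hfar : ¬ ∃ j : Fin N, j ∉ Ω ∧ dist (y (e a)) (y j) ≤ R) :
    ¬ GoodShell ((Measure.count : Measure E3).restrict ((fun z => z - y (e a)) '' Set.range (y ∘ e))) ∧
      ∀ b : Fin M, dist (y (e a)) (y (e b)) ≤ R₀ →
        LooseGoodShell θ ((Measure.count : Measure E3).restrict ((fun z => z - y (e b)) '' Set.range (y ∘ e))) := by
  have hin : ∀ k : Fin N, dist (y (e a)) (y k) ≤ R → k ∈ Ω := fun k hk => by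
    by_contra hkΩ
    exact hfar ⟨k, hkΩ, hk⟩
  refine ⟨fun hgood => hbad ((congr_of_deep (G := GoodShell)
    (fun h => ShellNoBoundary.goodShell_congr_of_local h) y hΩe (by linarith : (5 : ℝ) / 4 ≤ R) hin).2 hgood),
    fun b hb => ?_⟩
  refine (congr_of_deep (G := LooseGoodShell θ) (fun h => NecessityBlocks.looseGood_congr_of_local hθ h)
    y hΩe le_rfl fun k hk => hin k ?_).1 (hΩ _ (mem_of_map_eq hΩe b))
  calc dist (y (e a)) (y k) ≤ dist (y (e a)) (y (e b)) + dist (y (e b)) (y k) := dist_triangle _ _ _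
    _ ≤ R₀ + 5 / 4 := add_le_add hb hk
    _ ≤ R := hR

/-- Counting along an enumeration `e` of `Ω`: if `P (e a) ∧ ¬ D (e a)` implies `Q a`, then
`#{i ∈ Ω, P i} ≤ #{a, Q a} + #{i ∈ Ω, D i}`. -/
theorem card_le_of_imp {N M : ℕ} {Ω : Finset (Fin N)} {e : Fin M ↪ Fin N}
    (hΩe : Finset.univ.map e = Ω) {P D : Fin N → Prop} {Q : Fin M → Prop}
    (h : ∀ a : Fin M, P (e a) → ¬ D (e a) → Q a) :
    Nat.card {i : Fin N // i ∈ Ω ∧ P i} ≤ Nat.card {a : Fin M // Q a} + Nat.card {i : Fin N // i ∈ Ω ∧ D i} := by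
  simp only [Nat.card_eq_fintype_card, Fintype.card_subtype]
  have hsub : (Finset.univ.filter fun i : Fin N => i ∈ Ω ∧ P i) ⊆
      (Finset.univ.filter Q).map e ∪ Finset.univ.filter fun i : Fin N => i ∈ Ω ∧ D i := by
    intro i hi
    obtain ⟨hiΩ, hP⟩ := (Finset.mem_filter.1 hi).2
    rw [Finset.mem_union, Finset.mem_map, Finset.mem_filter]
    by_cases hD : D i
    · exact Or.inr ⟨Finset.mem_univ _, hiΩ, hD⟩
    · obtain ⟨a, rfl⟩ := exists_of_map_eq hΩe hiΩ
      exact Or.inl ⟨a, Finset.mem_filter.2 ⟨Finset.mem_univ _, h a hP hD⟩, rfl⟩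
  calc (Finset.univ.filter fun i : Fin N => i ∈ Ω ∧ P i).card
      ≤ ((Finset.univ.filter Q).map e ∪ Finset.univ.filter fun i : Fin N => i ∈ Ω ∧ D i).card :=
        Finset.card_le_card hsub
    _ ≤ ((Finset.univ.filter Q).map e).card + (Finset.univ.filter fun i : Fin N => i ∈ Ω ∧ D i).card :=
        Finset.card_union_le _ _
    _ = (Finset.univ.filter Q).card + (Finset.univ.filter fun i : Fin N => i ∈ Ω ∧ D i).card := by
        rw [Finset.card_map]

/-- **Finely bad indices of `Ω` are priced in `y|Ω` up to the `R`-boundary**: with every index of `Ω`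
`θ`-loosely well shelled in `y`, `R ≥ R₀ + 5/4`,
`#{i ∈ Ω finely bad in y} ≤ #{a finely bad in y ∘ e with R₀-neighbourhood θ-loosely good in y ∘ e} + #(R-boundary)`. -/
theorem card_fineBad_le {N M : ℕ} (y : Fin N → E3) {Ω : Finset (Fin N)} {e : Fin M ↪ Fin N}
    (hΩe : Finset.univ.map e = Ω) {θ R₀ R : ℝ} (hθ : 0 ≤ θ) (hR₀ : 0 ≤ R₀) (hR : R₀ + 5 / 4 ≤ R)
    (hΩ : ∀ i ∈ Ω, LooseGoodShell θ
      ((Measure.count : Measure E3).restrict ((fun z => z - y i) '' Set.range y))) :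
    (Nat.card {i : Fin N // i ∈ Ω ∧
        ¬ GoodShell ((Measure.count : Measure E3).restrict ((fun z => z - y i) '' Set.range y))} : ℝ) ≤
      (Nat.card {a : Fin M //
          ¬ GoodShell ((Measure.count : Measure E3).restrict ((fun z => z - y (e a)) '' Set.range (y ∘ e))) ∧
          ∀ b : Fin M, dist (y (e a)) (y (e b)) ≤ R₀ →
            LooseGoodShell θ
              ((Measure.count : Measure E3).restrict ((fun z => z - y (e b)) '' Set.range (y ∘ e)))} : ℝ) +
        Nat.card {i : Fin N // i ∈ Ω ∧ ∃ j : Fin N, j ∉ Ω ∧ dist (y i) (y j) ≤ R} := by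
  exact_mod_cast card_le_of_imp hΩe
    (P := fun i => ¬ GoodShell ((Measure.count : Measure E3).restrict ((fun z => z - y i) '' Set.range y)))
    (D := fun i => ∃ j : Fin N, j ∉ Ω ∧ dist (y i) (y j) ≤ R)
    (Q := fun a => ¬ GoodShell ((Measure.count : Measure E3).restrict
        ((fun z => z - y (e a)) '' Set.range (y ∘ e))) ∧
      ∀ b : Fin M, dist (y (e a)) (y (e b)) ≤ R₀ →
        LooseGoodShell θ ((Measure.count : Measure E3).restrict ((fun z => z - y (e b)) '' Set.range (y ∘ e))))
    fun a hP hD => fineBad_transfer y hΩe hθ hR₀ hR hΩ a hP hD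

/-! ## The stub -/

/-- **Stub `stub_inSituTransfer` of line `elastic-coarse-to-fine` (crux `MinimiserShells`,
stmt-AtomisticToContinuum-9225).**  IN-SITU TRANSFER: cluster coercivity (for some `c > 0` and every `ε > 0`
some `R > 0`, `C ≥ 0` make every finite injective `1/3`-separated cluster `y` satisfy
`c·#{finely bad with coarsely good R-neighbourhood} − C·#{coarsely bad} − ε·N ≤ 𝓔_N(y) − N·e*`) implies the
in-situ local inequality `H` (same `c`; for every `ε > 0` some `R > 0`, `C ≥ 0` make every coarsely good
index set `Ω` of every such `y` satisfy
`c·#{i ∈ Ω finely bad} − C·#(R-boundary of Ω) − ε·#Ω ≤ Σ_{i∈Ω} (𝓔ⁱ(y)/2 − e*)`).  Take `R₀, C₀` for `ε/2`,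
`R = R₀ + 5/4 + 13500/ε`, `C = c + C₀ + (6R+1)³/24`; restrict to `Ω`, split the energy
(`sum_siteEnergy_eq`), price the cross terms (`cross_sum_ge`) and transfer both shell predicates by locality
(`card_fineBad_le`, `card_coarseBad_le`). -/
theorem stub_inSituTransfer :
    (∃ c : ℝ, 0 < c ∧ ∀ ε : ℝ, 0 < ε → ∃ R : ℝ, 0 < R ∧ ∃ C : ℝ, 0 ≤ C ∧
      ∀ (N : ℕ) (y : Fin N → E3), Function.Injective y →
        (∀ i j : Fin N, i ≠ j → (1 : ℝ) / 3 ≤ dist (y i) (y j)) →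
        c * (Nat.card {i : Fin N //
              ¬ GoodShell ((Measure.count : Measure E3).restrict ((fun z => z - y i) '' Set.range y)) ∧
              ∀ j : Fin N, dist (y i) (y j) ≤ R →
                LooseGoodShell (1 / 20)
                  ((Measure.count : Measure E3).restrict ((fun z => z - y j) '' Set.range y))} : ℝ)
          - C * (Nat.card {j : Fin N //
              ¬ LooseGoodShell (1 / 20)
                ((Measure.count : Measure E3).restrict ((fun z => z - y j) '' Set.range y))} : ℝ)
          - ε * (N : ℝ)
        ≤ interactionEnergy lennardJones y - (N : ℝ) * eStar) →
    (∃ c : ℝ, 0 < c ∧ ∀ ε : ℝ, 0 < ε → ∃ R : ℝ, 0 < R ∧ ∃ C : ℝ, 0 ≤ C ∧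
      ∀ (N : ℕ) (y : Fin N → E3), Function.Injective y →
        (∀ i j : Fin N, i ≠ j → (1 : ℝ) / 3 ≤ dist (y i) (y j)) →
        ∀ Ω : Finset (Fin N),
          (∀ i ∈ Ω, LooseGoodShell (1 / 20)
            ((Measure.count : Measure E3).restrict ((fun z => z - y i) '' Set.range y))) →
          c * (Nat.card {i : Fin N // i ∈ Ω ∧
                ¬ GoodShell ((Measure.count : Measure E3).restrict ((fun z => z - y i) '' Set.range y))} : ℝ)
            - C * (Nat.card {i : Fin N // i ∈ Ω ∧ ∃ j : Fin N, j ∉ Ω ∧ dist (y i) (y j) ≤ R} : ℝ)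
            - ε * (Ω.card : ℝ)
          ≤ ∑ i ∈ Ω, (siteEnergy lennardJones y i / 2 - eStar)) := by
  rintro ⟨c, hc, hA⟩
  refine ⟨c, hc, fun ε hε => ?_⟩
  obtain ⟨R₀, hR₀, C₀, hC₀, hA'⟩ := hA (ε / 2) (half_pos hε)
  -- the radius `R = R₀ + 5/4 + 13500/ε` and the charge `C = c + C₀ + (6R+1)³/24`
  obtain ⟨R, hRdef⟩ : ∃ R : ℝ, R = R₀ + 5 / 4 + 13500 / ε := ⟨_, rfl⟩
  have hε' : (0 : ℝ) ≤ 13500 / ε := by positivity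
  have hR54 : R₀ + 5 / 4 ≤ R := by rw [hRdef]; linarith
  have hR3 : (1 : ℝ) / 3 ≤ R := by linarith
  have hRpos : 0 < R := by linarith
  have hRε : 13500 * R⁻¹ ^ 2 ≤ ε := by
    have h1 : 13500 / ε ≤ R := by rw [hRdef]; linarith
    have h2 : 13500 ≤ R * ε := (div_le_iff₀ hε).1 h1
    have h3 : 0 ≤ ε * R * (R - 1) := mul_nonneg (mul_nonneg hε.le hRpos.le) (by linarith)
    rw [inv_pow, ← div_eq_mul_inv, div_le_iff₀ (by positivity : (0 : ℝ) < R ^ 2)]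
    nlinarith
  refine ⟨R, hRpos, c + C₀ + (6 * R + 1) ^ 3 / 24, by positivity, fun N y hy hsep Ω hΩ => ?_⟩
  -- restrict `y` to `Ω` along the increasing enumeration `e`
  set e : Fin Ω.card ↪ Fin N := (Ω.orderEmbOfFin rfl).toEmbedding with he
  have hΩe : Finset.univ.map e = Ω := Finset.map_orderEmbOfFin_univ Ω rfl
  have hzinj : Function.Injective (y ∘ e) := hy.comp e.injective
  have hzsep : ∀ a b : Fin Ω.card, a ≠ b → (1 : ℝ) / 3 ≤ dist ((y ∘ e) a) ((y ∘ e) b) :=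
    fun a b hab => hsep (e a) (e b) fun h => hab (e.injective h)
  -- cluster coercivity on the restriction
  have hz := hA' Ω.card (y ∘ e) hzinj hzsep
  simp only [Function.comp_apply] at hz
  -- energy split and cross terms
  have hE := sum_siteEnergy_eq y hΩe
  have hX := cross_sum_ge y hy hsep Ω hR3
  -- locality
  have h5a := card_fineBad_le y hΩe (by norm_num : (0 : ℝ) ≤ 1 / 20) hR₀.le hR54 hΩ
  have h5b := card_coarseBad_le y hΩe (by norm_num : (0 : ℝ) ≤ 1 / 20) (by linarith : (5 : ℝ) / 4 ≤ R) hΩ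
  -- bookkeeping
  have hsumΩ : ∑ i ∈ Ω, (siteEnergy lennardJones y i / 2 - eStar) =
      (∑ i ∈ Ω, siteEnergy lennardJones y i) / 2 - eStar * Ω.card := by
    rw [Finset.sum_sub_distrib, Finset.sum_const, nsmul_eq_mul, Finset.sum_div, mul_comm]
  have hM0 : (0 : ℝ) ≤ Ω.card := Nat.cast_nonneg _
  have h1 := mul_le_mul_of_nonneg_left h5a hc.le
  have h2 := mul_le_mul_of_nonneg_left h5b hC₀
  have h3 := mul_le_mul_of_nonneg_right hRε hM0
  rw [hsumΩ]
  linarith
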